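import Literature.Probability.Percolation.FineBlocks
import HarnessLib

/-!
# Filling a finite set of blocks: the unbounded complementary component and the pockets

Topic `Probability/Percolation`.  Support file (definitions and proofs, no named fact) for the zone
geometry of the proof of Schramm–Smirnov's Prop. 4.1 (Ann. Probab. 39 (2011), §4), in the per-strip
form: the window of a strip is its thickened tube together with everything the tube and its end
squares ENCLOSE, so that the outside of the window is connected by construction.  This file is the
elementary block topology of that filling, on finite subsets of `ℤ × ℤ` with 4-adjacency
(`FineBlocks.OneStep`):

* `Conn S a b` — joined by a chain of 4-adjacent blocks inside `S`; straight walks;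
* `Out X a` — `a` escapes the finite set `X`: it is joined outside `X` to a block to the right of
  every block of `X`; blocks above / below / left / right of `X` escape (`out_of_above`, …), so the
  blocks that do not escape lie in the bounding box (`mem_bbox_of_not_out`); any two escaping blocks
  are joined outside `X` (`conn_of_out`: the unbounded component is ONE component);
* `fill X` — the blocks that do not escape (`mem_fill_iff`), a finite set containing `X`, inside the
  bounding box, MONOTONE in the strong form `X ⊆ fill Y → fill X ⊆ fill Y` (`fill_subset_fill`), and
  a 4-connected set of blocks disjoint from `X` escapes entirely or not at all (`out_iff_of_conn`);
* `exists_top_left` — a finite nonempty set of blocks has a block with no block of the set above it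
  or immediately to its left (used to show that squares enclose nothing).

## References

* O. Schramm, S. Smirnov, Ann. Probab. 39 (2011), arXiv:1101.5820, §4, proof of Prop. 4.1 (the
  strips `K_j` between `β_j`, `β'_j` and the circles). [SchrammSmirnov2011]
* A. Rosenfeld, *Connectivity in digital pictures*, J. ACM 17 (1970) (4- and 8-connectivity of
  finite sets of lattice squares). [folklore]
-/

noncomputable section

open Set Relation
open scoped Classical

namespace Literature.Probability.Percolation

namespace FineBlocks

/-! ### Chains of 4-adjacent blocks -/

/-- **Joined inside `S` by 4-adjacent blocks.** [folklore] -/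
def Conn (S : Set (ℤ × ℤ)) (a b : ℤ × ℤ) : Prop := ReflTransGen (fun x y => x ∈ S ∧ y ∈ S ∧ OneStep x y) a b

variable {S T : Set (ℤ × ℤ)} {a b c : ℤ × ℤ}

/-- `conn_refl` (conn refl). [folklore] -/
theorem conn_refl : Conn S a a := ReflTransGen.refl

/-- `Conn.trans` (Conn.trans). [folklore] -/
theorem Conn.trans (h : Conn S a b) (h' : Conn S b c) : Conn S a c := ReflTransGen.trans h h'

/-- `Conn.symm` (Conn.symm). [folklore] -/
theorem Conn.symm (h : Conn S a b) : Conn S b a := by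
  unfold Conn at h ⊢
  induction h with
  | refl => exact ReflTransGen.refl
  | tail _ hst ih => exact ReflTransGen.head ⟨hst.2.1, hst.1, hst.2.2.symm⟩ ih

/-- `Conn.mono` (Conn.mono). [folklore] -/
theorem Conn.mono (hST : S ⊆ T) (h : Conn S a b) : Conn T a b :=
  reflTransGen_of_imp (fun _ _ ⟨hx, hy, hxy⟩ => ⟨hST hx, hST hy, hxy⟩) h

/-- The end of a nontrivial chain inside `S` is in `S`. [folklore] -/
theorem Conn.mem_or_eq (h : Conn S a b) : b ∈ S ∨ b = a := by
  unfold Conn at h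
  induction h with
  | refl => exact Or.inr rfl
  | tail _ hst _ => exact Or.inl hst.2.1

/-- `Conn.mem` (Conn.mem). [folklore] -/
theorem Conn.mem (h : Conn S a b) (ha : a ∈ S) : b ∈ S := by
  rcases h.mem_or_eq with h | rfl
  exacts [h, ha]

/-- `Conn.mem'` (Conn.mem'). [folklore] -/
theorem Conn.mem' (h : Conn S a b) (hb : b ∈ S) : a ∈ S := h.symm.mem hb

/-- `conn_single` (conn single). [folklore] -/
theorem conn_single (ha : a ∈ S) (hb : b ∈ S) (h : OneStep a b) : Conn S a b := ReflTransGen.single ⟨ha, hb, h⟩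

/-- Induction along a chain from its end: a property of the end that pulls back along steps inside
`S` (from blocks still joined to the end) holds at the start. [folklore] -/
theorem Conn.head_induction {P : ℤ × ℤ → Prop} (h : Conn S a b) (hb : P b)
    (hstep : ∀ x y, x ∈ S → y ∈ S → OneStep x y → Conn S y b → P y → P x) : P a := by
  unfold Conn at h
  induction h using ReflTransGen.head_induction_on with
  | refl => exact hb
  | head hxy hyb ih => exact hstep _ _ hxy.1 hxy.2.1 hxy.2.2 hyb ih

/-! ### Straight walks -/

/-- `oneStep_right` (oneStep right). [folklore] -/
theorem oneStep_right (a : ℤ × ℤ) : OneStep a (a.1 + 1, a.2) := Or.inr ⟨rfl, by simp⟩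

/-- `oneStep_left` (oneStep left). [folklore] -/
theorem oneStep_left (a : ℤ × ℤ) : OneStep a (a.1 - 1, a.2) := Or.inr ⟨rfl, by simp⟩

/-- `oneStep_up` (oneStep up). [folklore] -/
theorem oneStep_up (a : ℤ × ℤ) : OneStep a (a.1, a.2 + 1) := Or.inl ⟨rfl, by simp⟩

/-- `oneStep_down` (oneStep down). [folklore] -/
theorem oneStep_down (a : ℤ × ℤ) : OneStep a (a.1, a.2 - 1) := Or.inl ⟨rfl, by simp⟩

/-- A walk by iterating a step map inside `S`. [folklore] -/
theorem conn_iterate (f : ℤ × ℤ → ℤ × ℤ) (hf : ∀ z, OneStep z (f z)) (a : ℤ × ℤ) (n : ℕ)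
    (h : ∀ i ≤ n, f^[i] a ∈ S) : Conn S a (f^[n] a) := by
  induction n with
  | zero => exact conn_refl
  | succ n ih =>
    have h1 := ih fun i hi => h i (Nat.le_succ_of_le hi)
    refine h1.trans (conn_single (h n (Nat.le_succ _)) (h (n + 1) le_rfl) ?_)
    rw [Function.iterate_succ_apply']; exact hf _

/-- `iterate_right` (iterate right). [folklore] -/
theorem iterate_right (a : ℤ × ℤ) (n : ℕ) : (fun z : ℤ × ℤ => (z.1 + 1, z.2))^[n] a = (a.1 + n, a.2) := by
  induction n with
  | zero => simp
  | succ n ih => rw [Function.iterate_succ_apply', ih]; simp only [Nat.cast_succ, Prod.mk.injEq]; exact ⟨by ring, trivial⟩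

/-- `iterate_left` (iterate left). [folklore] -/
theorem iterate_left (a : ℤ × ℤ) (n : ℕ) : (fun z : ℤ × ℤ => (z.1 - 1, z.2))^[n] a = (a.1 - n, a.2) := by
  induction n with
  | zero => simp
  | succ n ih => rw [Function.iterate_succ_apply', ih]; simp only [Nat.cast_succ, Prod.mk.injEq]; exact ⟨by ring, trivial⟩

/-- `iterate_up` (iterate up). [folklore] -/
theorem iterate_up (a : ℤ × ℤ) (n : ℕ) : (fun z : ℤ × ℤ => (z.1, z.2 + 1))^[n] a = (a.1, a.2 + n) := by
  induction n with
  | zero => simp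
  | succ n ih => rw [Function.iterate_succ_apply', ih]; simp only [Nat.cast_succ, Prod.mk.injEq]; exact ⟨trivial, by ring⟩

/-- `iterate_down` (iterate down). [folklore] -/
theorem iterate_down (a : ℤ × ℤ) (n : ℕ) : (fun z : ℤ × ℤ => (z.1, z.2 - 1))^[n] a = (a.1, a.2 - n) := by
  induction n with
  | zero => simp
  | succ n ih => rw [Function.iterate_succ_apply', ih]; simp only [Nat.cast_succ, Prod.mk.injEq]; exact ⟨trivial, by ring⟩

/-- Walking right inside `S`. [folklore] -/
theorem conn_right (a : ℤ × ℤ) (n : ℕ) (h : ∀ i : ℕ, i ≤ n → (a.1 + i, a.2) ∈ S) : Conn S a (a.1 + n, a.2) := by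
  have := conn_iterate (S := S) _ oneStep_right a n (fun i hi => by rw [iterate_right]; exact h i hi)
  rwa [iterate_right] at this

/-- Walking left inside `S`. [folklore] -/
theorem conn_left (a : ℤ × ℤ) (n : ℕ) (h : ∀ i : ℕ, i ≤ n → (a.1 - i, a.2) ∈ S) : Conn S a (a.1 - n, a.2) := by
  have := conn_iterate (S := S) _ oneStep_left a n (fun i hi => by rw [iterate_left]; exact h i hi)
  rwa [iterate_left] at this

/-- Walking up inside `S`. [folklore] -/
theorem conn_up (a : ℤ × ℤ) (n : ℕ) (h : ∀ i : ℕ, i ≤ n → (a.1, a.2 + i) ∈ S) : Conn S a (a.1, a.2 + n) := by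
  have := conn_iterate (S := S) _ oneStep_up a n (fun i hi => by rw [iterate_up]; exact h i hi)
  rwa [iterate_up] at this

/-- Walking down inside `S`. [folklore] -/
theorem conn_down (a : ℤ × ℤ) (n : ℕ) (h : ∀ i : ℕ, i ≤ n → (a.1, a.2 - i) ∈ S) : Conn S a (a.1, a.2 - n) := by
  have := conn_iterate (S := S) _ oneStep_down a n (fun i hi => by rw [iterate_down]; exact h i hi)
  rwa [iterate_down] at this

/-! ### Bounds of a finite set of blocks -/

variable (X : Finset (ℤ × ℤ))

/-- `exists_gt_fst` (exists gt fst). [folklore] -/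
theorem exists_gt_fst : ∃ M : ℤ, ∀ x ∈ X, x.1 < M := by
  obtain ⟨M, hM⟩ := (X.image Prod.fst).finite_toSet.bddAbove
  exact ⟨M + 1, fun x hx => by have := hM (Finset.mem_coe.2 (Finset.mem_image_of_mem _ hx)); omega⟩

/-- `exists_lt_fst` (exists lt fst). [folklore] -/
theorem exists_lt_fst : ∃ M : ℤ, ∀ x ∈ X, M < x.1 := by
  obtain ⟨M, hM⟩ := (X.image Prod.fst).finite_toSet.bddBelow
  exact ⟨M - 1, fun x hx => by have := hM (Finset.mem_coe.2 (Finset.mem_image_of_mem _ hx)); omega⟩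

/-- `exists_gt_snd` (exists gt snd). [folklore] -/
theorem exists_gt_snd : ∃ M : ℤ, ∀ x ∈ X, x.2 < M := by
  obtain ⟨M, hM⟩ := (X.image Prod.snd).finite_toSet.bddAbove
  exact ⟨M + 1, fun x hx => by have := hM (Finset.mem_coe.2 (Finset.mem_image_of_mem _ hx)); omega⟩

/-- `exists_lt_snd` (exists lt snd). [folklore] -/
theorem exists_lt_snd : ∃ M : ℤ, ∀ x ∈ X, M < x.2 := by
  obtain ⟨M, hM⟩ := (X.image Prod.snd).finite_toSet.bddBelow
  exact ⟨M - 1, fun x hx => by have := hM (Finset.mem_coe.2 (Finset.mem_image_of_mem _ hx)); omega⟩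

/-! ### Escaping -/

/-- **`a` escapes `X`**: it is joined, through blocks not in `X`, to a block strictly to the right of
every block of `X`. [folklore] -/
def Out (a : ℤ × ℤ) : Prop := ∃ b : ℤ × ℤ, (∀ x ∈ X, x.1 < b.1) ∧ Conn (↑X)ᶜ a b

variable {X}

/-- `out_of_right` (out of right). [folklore] -/
theorem out_of_right (h : ∀ x ∈ X, x.1 < a.1) : Out X a := ⟨a, h, conn_refl⟩

/-- `Out.of_conn` (Out.of conn). [folklore] -/
theorem Out.of_conn (h : Conn (↑X)ᶜ a b) (hb : Out X b) : Out X a := by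
  obtain ⟨c, hc, hbc⟩ := hb; exact ⟨c, hc, h.trans hbc⟩

/-- `Out.not_mem` (Out.not mem). [folklore] -/
theorem Out.not_mem (h : Out X a) : a ∉ X := by
  obtain ⟨b, hb, hab⟩ := h
  rcases hab.symm.mem_or_eq with h | rfl
  · exact h
  · exact fun ha => lt_irrefl _ (hb _ ha)

/-- Blocks above `X` escape. [folklore] -/
theorem out_of_above (h : ∀ x ∈ X, x.2 < a.2) : Out X a := by
  obtain ⟨M, hM⟩ := exists_gt_fst X
  refine Out.of_conn (conn_right (S := (↑X)ᶜ) a (M - a.1).toNat fun i _ hx => ?_) (out_of_right fun x hx => ?_)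
  · exact absurd (h (a.1 + i, a.2) hx) (lt_irrefl _)
  · have := hM x hx
    simp only
    omega

/-- Blocks below `X` escape. [folklore] -/
theorem out_of_below (h : ∀ x ∈ X, a.2 < x.2) : Out X a := by
  obtain ⟨M, hM⟩ := exists_gt_fst X
  refine Out.of_conn (conn_right (S := (↑X)ᶜ) a (M - a.1).toNat fun i _ hx => ?_) (out_of_right fun x hx => ?_)
  · exact absurd (h (a.1 + i, a.2) hx) (lt_irrefl _)
  · have := hM x hx
    simp only
    omega

/-- Blocks left of `X` escape (up, then right). [folklore] -/
theorem out_of_left (h : ∀ x ∈ X, a.1 < x.1) : Out X a := by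
  obtain ⟨N, hN⟩ := exists_gt_snd X
  refine Out.of_conn (conn_up (S := (↑X)ᶜ) a (N - a.2).toNat fun i _ hx => ?_) (out_of_above fun x hx => ?_)
  · exact absurd (h (a.1, a.2 + i) hx) (lt_irrefl _)
  · have := hN x hx
    simp only
    omega

/-- **Blocks that do not escape lie in the bounding box.** [folklore] -/
theorem bounds_of_not_out (h : ¬ Out X a) :
    (∃ x ∈ X, a.1 ≤ x.1) ∧ (∃ x ∈ X, x.1 ≤ a.1) ∧ (∃ x ∈ X, a.2 ≤ x.2) ∧ (∃ x ∈ X, x.2 ≤ a.2) := by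
  refine ⟨?_, ?_, ?_, ?_⟩ <;> by_contra hc <;> push Not at hc
  · exact h (out_of_right hc)
  · exact h (out_of_left hc)
  · exact h (out_of_above hc)
  · exact h (out_of_below hc)

/-- Two blocks to the right of `X` are joined outside `X`. [folklore] -/
theorem conn_of_right_of_right (ha : ∀ x ∈ X, x.1 < a.1) (hb : ∀ x ∈ X, x.1 < b.1) : Conn (↑X)ᶜ a b := by
  -- go right from both to the column `C = max a.1 b.1`, then vertically
  set C := max a.1 b.1 with hC
  have h1 : Conn (↑X)ᶜ a (a.1 + ((C - a.1).toNat : ℕ), a.2) :=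
    conn_right a _ fun i _ hx => lt_irrefl _ ((ha _ hx).trans_le (by simp only; omega))
  have h2 : Conn (↑X)ᶜ b (b.1 + ((C - b.1).toNat : ℕ), b.2) :=
    conn_right b _ fun i _ hx => lt_irrefl _ ((hb _ hx).trans_le (by simp only; omega))
  have hCa : a.1 + ((C - a.1).toNat : ℕ) = C := by omega
  have hCb : b.1 + ((C - b.1).toNat : ℕ) = C := by omega
  rw [hCa] at h1
  rw [hCb] at h2
  have hCX : ∀ x ∈ X, x.1 < C := fun x hx => (ha x hx).trans_le (le_max_left _ _)
  -- vertical segment at column `C`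
  have h3 : Conn (↑X)ᶜ (C, a.2) (C, b.2) := by
    rcases le_total a.2 b.2 with hle | hle
    · have := conn_up (S := (↑X)ᶜ) (C, a.2) (b.2 - a.2).toNat fun i _ hx => lt_irrefl _ (hCX _ hx)
      rwa [show ((C, a.2) : ℤ × ℤ).2 + ((b.2 - a.2).toNat : ℕ) = b.2 by simp only; omega] at this
    · have := conn_down (S := (↑X)ᶜ) (C, a.2) (a.2 - b.2).toNat fun i _ hx => lt_irrefl _ (hCX _ hx)
      rwa [show ((C, a.2) : ℤ × ℤ).2 - ((a.2 - b.2).toNat : ℕ) = b.2 by simp only; omega] at this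
  exact (h1.trans h3).trans h2.symm

/-- **The escaping blocks form one component**: any two are joined outside `X`. [folklore] -/
theorem conn_of_out (ha : Out X a) (hb : Out X b) : Conn (↑X)ᶜ a b := by
  obtain ⟨a', ha', haa'⟩ := ha
  obtain ⟨b', hb', hbb'⟩ := hb
  exact (haa'.trans (conn_of_right_of_right ha' hb')).trans hbb'.symm

/-- Along a chain outside `X`, escaping is invariant. [folklore] -/
theorem out_iff_of_conn_compl (h : Conn (↑X)ᶜ a b) : Out X a ↔ Out X b :=
  ⟨fun ha => Out.of_conn h.symm ha, fun hb => Out.of_conn h hb⟩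

/-- **A 4-connected set of blocks disjoint from `X` escapes entirely or not at all.** [folklore] -/
theorem out_iff_of_conn {C : Set (ℤ × ℤ)} (hCX : Disjoint C ↑X) (h : Conn C a b) : Out X a ↔ Out X b :=
  out_iff_of_conn_compl (h.mono fun _ hz hzX => hCX.le_bot ⟨hz, hzX⟩)

/-! ### The bounding box and the filling -/

/-- The span of a finite set of integers: everything between two of its elements. [folklore] -/
def span (A : Finset ℤ) : Finset ℤ := A.biUnion fun i => A.biUnion fun j => Finset.Icc i j

/-- `mem_span_iff` (mem span iff). [folklore] -/
theorem mem_span_iff {A : Finset ℤ} {k : ℤ} : k ∈ span A ↔ (∃ i ∈ A, i ≤ k) ∧ ∃ j ∈ A, k ≤ j := by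
  simp only [span, Finset.mem_biUnion, Finset.mem_Icc]
  constructor
  · rintro ⟨i, hi, j, hj, hik, hkj⟩; exact ⟨⟨i, hi, hik⟩, j, hj, hkj⟩
  · rintro ⟨⟨i, hi, hik⟩, j, hj, hkj⟩; exact ⟨i, hi, j, hj, hik, hkj⟩

variable (X) in
/-- **The bounding box** of a finite set of blocks. [folklore] -/
def bbox : Finset (ℤ × ℤ) := span (X.image Prod.fst) ×ˢ span (X.image Prod.snd)

/-- `mem_bbox_iff` (mem bbox iff). [folklore] -/
theorem mem_bbox_iff : a ∈ bbox X ↔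
    ((∃ x ∈ X, x.1 ≤ a.1) ∧ ∃ x ∈ X, a.1 ≤ x.1) ∧ (∃ x ∈ X, x.2 ≤ a.2) ∧ ∃ x ∈ X, a.2 ≤ x.2 := by
  simp only [bbox, Finset.mem_product, mem_span_iff, Finset.mem_image]
  constructor
  · rintro ⟨⟨⟨_, ⟨x, hx, rfl⟩, h1⟩, _, ⟨y, hy, rfl⟩, h2⟩, ⟨_, ⟨z, hz, rfl⟩, h3⟩, _, ⟨w, hw, rfl⟩, h4⟩
    exact ⟨⟨⟨x, hx, h1⟩, y, hy, h2⟩, ⟨z, hz, h3⟩, w, hw, h4⟩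
  · rintro ⟨⟨⟨x, hx, h1⟩, y, hy, h2⟩, ⟨z, hz, h3⟩, w, hw, h4⟩
    exact ⟨⟨⟨_, ⟨x, hx, rfl⟩, h1⟩, _, ⟨y, hy, rfl⟩, h2⟩, ⟨_, ⟨z, hz, rfl⟩, h3⟩, _, ⟨w, hw, rfl⟩, h4⟩

/-- `mem_bbox_of_mem` (mem bbox of mem). [folklore] -/
theorem mem_bbox_of_mem (ha : a ∈ X) : a ∈ bbox X :=
  mem_bbox_iff.2 ⟨⟨⟨a, ha, le_rfl⟩, a, ha, le_rfl⟩, ⟨a, ha, le_rfl⟩, a, ha, le_rfl⟩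

/-- `mem_bbox_of_not_out` (mem bbox of not out). [folklore] -/
theorem mem_bbox_of_not_out (h : ¬ Out X a) : a ∈ bbox X := by
  obtain ⟨h1, h2, h3, h4⟩ := bounds_of_not_out h
  exact mem_bbox_iff.2 ⟨⟨h2, h1⟩, h4, h3⟩

variable (X) in
/-- **The filling** of a finite set of blocks: the blocks that do not escape it (the set together with
the bounded components of its complement). [cite: SchrammSmirnov2011, §4, proof of Prop. 4.1 (the strips K_j; here: everything a strip encloses is put into its window)] -/
def fill : Finset (ℤ × ℤ) := (bbox X).filter fun a => ¬ Out X a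

/-- Membership in the filling: not escaping. [folklore] -/
theorem mem_fill_iff : a ∈ fill X ↔ ¬ Out X a := by
  rw [fill, Finset.mem_filter]
  exact ⟨fun h => h.2, fun h => ⟨mem_bbox_of_not_out h, h⟩⟩

/-- `subset_fill` (subset fill). [folklore] -/
theorem subset_fill : X ⊆ fill X := fun _ ha => mem_fill_iff.2 fun h => h.not_mem ha

/-- `fill_subset_bbox` (fill subset bbox). [folklore] -/
theorem fill_subset_bbox : fill X ⊆ bbox X := Finset.filter_subset _ _

/-- Bounds of the filling. [folklore] -/
theorem bounds_of_mem_fill (h : a ∈ fill X) :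
    (∃ x ∈ X, a.1 ≤ x.1) ∧ (∃ x ∈ X, x.1 ≤ a.1) ∧ (∃ x ∈ X, a.2 ≤ x.2) ∧ (∃ x ∈ X, x.2 ≤ a.2) :=
  bounds_of_not_out (mem_fill_iff.1 h)

/-- **Monotonicity of the filling, strong form**: a set inside the filling of `Y` has its filling
inside the filling of `Y`. [folklore] -/
theorem fill_subset_fill {Y : Finset (ℤ × ℤ)} (hXY : X ⊆ fill Y) : fill X ⊆ fill Y := by
  intro a ha
  rw [mem_fill_iff] at ha ⊢
  rintro ⟨b, hb, hab⟩
  apply ha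
  -- the end of the escaping chain is right of `X ⊆ fill Y ⊆ bbox Y`
  have hbX : ∀ x ∈ X, x.1 < b.1 := by
    intro x hx
    obtain ⟨y, hy, hxy⟩ := (bounds_of_mem_fill (hXY hx)).1
    exact hxy.trans_lt (hb y hy)
  -- every block of the chain escapes `Y`, hence is not in `X`
  have notX : ∀ {z}, Conn (↑Y)ᶜ z b → z ∉ X := fun hz hzX =>
    (mem_fill_iff.1 (hXY hzX)) ⟨b, hb, hz⟩
  refine hab.head_induction (P := Out X) (out_of_right hbX) fun x y _ _ hxy hyb hPy => ?_
  exact Out.of_conn (conn_single (notX ((conn_single ‹_› ‹_› hxy).trans hyb)) (notX hyb) hxy) hPy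

/-! ### Pockets -/

/-- A block outside a pocket block's component and 4-adjacent to it is in `X`: the rim of a pocket
lies in `X`. [folklore] -/
theorem mem_of_oneStep_of_not_out (ha : ¬ Out X a) (haX : a ∉ X) (hab : OneStep a b) (hb : Out X b ∨ b ∈ X) :
    b ∈ X := by
  rcases hb with hb | hb
  · by_contra hbX
    exact ha (Out.of_conn (conn_single haX hbX hab) hb)
  · exact hb

/-- **A finite nonempty set of blocks has a top-left block**: no block of the set lies strictly above
its row, and the block immediately to its left is not in the set. [folklore] -/
theorem exists_top_left {P : Finset (ℤ × ℤ)} (hP : P.Nonempty) :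
    ∃ q ∈ P, (∀ p ∈ P, p.2 ≤ q.2) ∧ (q.1 - 1, q.2) ∉ P := by
  obtain ⟨t, ht, htop⟩ := P.exists_max_image Prod.snd hP
  have hrow : (P.filter fun p => p.2 = t.2).Nonempty := ⟨t, Finset.mem_filter.2 ⟨ht, rfl⟩⟩
  obtain ⟨q, hq, hleft⟩ := (P.filter fun p => p.2 = t.2).exists_min_image Prod.fst hrow
  obtain ⟨hqP, hqt⟩ := Finset.mem_filter.1 hq
  refine ⟨q, hqP, fun p hp => hqt ▸ htop p hp, fun h => ?_⟩
  have := hleft _ (Finset.mem_filter.2 ⟨h, by simpa using hqt⟩)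
  simp only at this
  omega

end FineBlocks

end Literature.Probability.Percolation

end
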